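import Mathlib
import Summits.AtomisticToContinuum.HydrodynamicLimit.Theorems.InformationPercolationEngineKickFairRelEquilibriumMesoTransferSlots
import Summits.AtomisticToContinuum.HydrodynamicLimit.Theorems.InformationPercolationEngineKickFairRelEquilibriumMesoPastMeasurable
import Summits.AtomisticToContinuum.HydrodynamicLimit.Theorems.JParityClosureOddContactSymmetryGibbsInvariance
import Literature.MathematicalPhysics.KineticTheory.CollisionWindowStationarity
import Literature.MathematicalPhysics.KineticTheory.EvenStatTruncationBound
import HarnessLib

/-!
# `KickFairRelEquilibriumMeso`, line `Sketch` — NO LAST COLLISION UNDER THE INVARIANT LAW, AND THE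
# ENUMERATION OF COLLISION TIMES IS GENUINE ALMOST EVERYWHERE (plumbing of the restart-bias stub R-i″)

Helper file (`--supports stmt-AtomisticToContinuum-15177`) of the line lead (continuation c2). The crux centres the
`n`-th kick of sphere `i` at `κ_{i,n} = E_G[g(X_{i,n}) | σ(P_{i,n})]` and sums over `n < cnt_i(τ)`; but the enumeration
`n ↦ t_{i,n} = nthTimeAfter (collision times of i) 0 n` RECYCLES past the last collision of `i` (the junk value of
`nextTimeAfter` on an empty set is `0`, from which the iteration restarts), so the cut `{n < cnt_i(τ)}` is a function of
the typed past `P_{i,n}` (whose last component is `t_{i,n}`) only modulo the orbits on which `i` has at least one but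
FINITELY MANY collisions in `(0, ∞)` — the typing debt named in the crux's informal statement (14914 Disproof §5,
15177 Disproof D0: "to be shown `G`-null"). This file pays it, by INVARIANCE ALONE:

* `noCollAfter_eq_inter_preimage` — on the good set, "no collision of `i` after time `T`" is the `Φ_T`-preimage of
  "no collision of `i` after time `0`" (the orbit of `Φ_T z` is the `T`-shift of the orbit of `z`,
  `collisionTimesOf_flow_shift`);
* `measurableSet_noCollAfter_zero` — that event is measurable (countably many guarded window counts vanish);
* `measure_noCollAfter_eq` — hence all these events have the SAME mass under the invariant canonical law
  `G = localGibbsLaw σ c u θ N Φ` (constant profiles; `measurePreserving_flow_localGibbsLaw_const`);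
* `measure_finitelyManyCollisions_eq_zero` — they increase with `T` to "finitely many collisions after `0`", whose
  mass is therefore that of "no collision after `0`": **`G`-almost surely, a sphere that collides once collides
  unboundedly often** (`ae_collisions_unbounded`);
* `nthTimeAfter_mem_pos`, `nthTimeAfter_lt_succ`, `lt_ncard_of_nthTimeAfter_le`, `nthTimeAfter_eq_zero_of_empty` —
  the order structure of the enumeration on an unbounded locally finite set (it lists the set increasingly) and on
  an empty one (it is identically the junk `0`);
* `ae_lt_cnt_iff_mem_Ioc` — consequently, **`G`-a.e., for every `n`: `n < cnt_i(τ) ↔ t_{i,n} ∈ (0, τ]`**, so the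
  crux's cut IS past-measurable up to a `G`-null set, for every `n` (the `n = 0` case
  `cnt_pos_iff_nthCollisionTimeOf_mem` holds everywhere).

The companion file `…MesoFairGivenPast.lean` turns this into exact fairness of every windowed centred kick term
given its own past under `G` (all `n`; so far only `n = 0`, `firstKickFair`).
-/

noncomputable section

open MeasureTheory Set Filter Topology
open scoped ENNReal Classical

namespace Summit.AtomisticToContinuum.HydrodynamicLimit.Theorems.KickFairRelEquilibriumMesoLine

open Literature.Analysis.FluidPDE Literature.MathematicalPhysics.KineticTheory
open Summit.AtomisticToContinuum.HydrodynamicLimit.Theorems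

/-! ## The enumeration `nthTimeAfter` on unbounded locally finite sets and on empty ones -/

section Enumeration

variable {S : Set ℝ}

/-- **On a set that is locally finite after `0` and unbounded above, the enumeration from `0` lists elements of
the set, all positive**: `nthTimeAfter S 0 n ∈ S ∩ (0, ∞)` for every `n`. [folklore] -/
theorem nthTimeAfter_mem_pos (hfin : ∀ b, (S ∩ Ioc 0 b).Finite) (hunb : ∀ x, 0 ≤ x → (S ∩ Ioi x).Nonempty) :
    ∀ n, nthTimeAfter S 0 n ∈ S ∩ Ioi 0 := by
  have hfin' : ∀ x, 0 ≤ x → ∀ b, (S ∩ Ioc x b).Finite := fun x hx b =>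
    (hfin b).subset (inter_subset_inter_right _ (Ioc_subset_Ioc_left hx))
  intro n
  induction n with
  | zero =>
    rw [nthTimeAfter_zero]
    exact (isLeast_nextTimeAfter (hfin' 0 le_rfl) (hunb 0 le_rfl)).1
  | succ n ih =>
    rw [nthTimeAfter_succ]
    have h := (isLeast_nextTimeAfter (hfin' _ ih.2.le) (hunb _ ih.2.le)).1
    exact ⟨h.1, mem_Ioi.2 (lt_trans (mem_Ioi.1 ih.2) (mem_Ioi.1 h.2))⟩

/-- **… and lists them increasingly**: `nthTimeAfter S 0 n < nthTimeAfter S 0 (n+1)`. [folklore] -/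
theorem nthTimeAfter_lt_succ (hfin : ∀ b, (S ∩ Ioc 0 b).Finite) (hunb : ∀ x, 0 ≤ x → (S ∩ Ioi x).Nonempty)
    (n : ℕ) : nthTimeAfter S 0 n < nthTimeAfter S 0 (n + 1) := by
  have hfin' : ∀ x, 0 ≤ x → ∀ b, (S ∩ Ioc x b).Finite := fun x hx b =>
    (hfin b).subset (inter_subset_inter_right _ (Ioc_subset_Ioc_left hx))
  have hn := nthTimeAfter_mem_pos hfin hunb n
  rw [nthTimeAfter_succ]
  exact (isLeast_nextTimeAfter (hfin' _ hn.2.le) (hunb _ hn.2.le)).1.2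

/-- **… so that an index whose time is at most `b` is below the count in `(0, b]`**: the times of indices `0, …, n`
are `n + 1` distinct elements of `S ∩ (0, b]`. [folklore] -/
theorem lt_ncard_of_nthTimeAfter_le (hfin : ∀ b, (S ∩ Ioc 0 b).Finite)
    (hunb : ∀ x, 0 ≤ x → (S ∩ Ioi x).Nonempty) {n : ℕ} {b : ℝ} (hle : nthTimeAfter S 0 n ≤ b) :
    n < (S ∩ Ioc 0 b).ncard := by
  have hmono : StrictMono fun k => nthTimeAfter S 0 k := strictMono_nat_of_lt_succ (nthTimeAfter_lt_succ hfin hunb)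
  set T : Finset ℝ := (Finset.range (n + 1)).image fun k => nthTimeAfter S 0 k with hT
  have hcard : T.card = n + 1 := by
    rw [hT, Finset.card_image_of_injective _ hmono.injective, Finset.card_range]
  have hsub : (T : Set ℝ) ⊆ S ∩ Ioc 0 b := by
    intro x hx
    rw [hT, Finset.coe_image] at hx
    obtain ⟨k, hk, rfl⟩ := hx
    have hk' : k ≤ n := Nat.lt_succ_iff.1 (Finset.mem_range.1 (Finset.mem_coe.1 hk))
    have hmem := nthTimeAfter_mem_pos hfin hunb k
    exact ⟨hmem.1, hmem.2, (hmono.monotone hk').trans hle⟩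
  have h := Set.ncard_le_ncard hsub (hfin b)
  rw [Set.ncard_coe_finset, hcard] at h
  exact h

/-- **On a set with no element after `0`, the enumeration from `0` is identically the junk value `0`**
(`nextTimeAfter S 0 = sInf ∅ = 0`, and the iteration restarts from `0`). [folklore] -/
theorem nthTimeAfter_eq_zero_of_empty (hS : S ∩ Ioi 0 = ∅) : ∀ n, nthTimeAfter S 0 n = 0 := by
  intro n
  induction n with
  | zero => rw [nthTimeAfter_zero, nextTimeAfter_of_eq_empty hS]
  | succ n ih => rw [nthTimeAfter_succ, ih, nextTimeAfter_of_eq_empty hS]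

end Enumeration

/-! ## No last collision under the invariant law -/

section NoLast

variable {σ : ℝ} {N : ℕ}

/-- **"No collision of `i` after `T`" is the `Φ_T`-preimage of "no collision of `i` after `0`", on the good set**: the
collision times of `i` along the orbit of `Φ_T z` are those along the orbit of `z` shifted by `−T`. [folklore] -/
theorem noCollAfter_eq_inter_preimage (Φ : Flow σ N) (i : Fin (N + 1)) (T : ℝ) :
    {z : Phase N | z ∈ Φ.good ∧
      collisionTimesOf (Torus.geometry (Fin 3)) (hsDiameter σ N) (fun s => Φ.flow s z) i ∩ Ioi T = ∅} =
    Φ.good ∩ (Φ.flow T) ⁻¹' {z : Phase N | z ∈ Φ.good ∧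
      collisionTimesOf (Torus.geometry (Fin 3)) (hsDiameter σ N) (fun s => Φ.flow s z) i ∩ Ioi 0 = ∅} := by
  ext z
  simp only [mem_setOf_eq, mem_inter_iff, mem_preimage]
  constructor
  · rintro ⟨hz, hT⟩
    refine ⟨hz, Φ.mapsTo_good T hz, ?_⟩
    rw [collisionTimesOf_flow_shift Φ hz T i]
    ext u
    simp only [mem_inter_iff, mem_preimage, mem_Ioi, mem_empty_iff_false, iff_false, not_and, not_lt]
    intro hu
    by_contra hlt
    push Not at hlt
    have : u + T ∈ collisionTimesOf (Torus.geometry (Fin 3)) (hsDiameter σ N) (fun s => Φ.flow s z) i ∩ Ioi T :=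
      ⟨hu, by simp only [mem_Ioi]; linarith⟩
    rw [hT] at this
    exact this
  · rintro ⟨hz, -, h0⟩
    refine ⟨hz, ?_⟩
    rw [collisionTimesOf_flow_shift Φ hz T i] at h0
    ext u
    simp only [mem_inter_iff, mem_Ioi, mem_empty_iff_false, iff_false, not_and, not_lt]
    intro hu
    by_contra hlt
    push Not at hlt
    have : u - T ∈ (fun v => v + T) ⁻¹'
        collisionTimesOf (Torus.geometry (Fin 3)) (hsDiameter σ N) (fun s => Φ.flow s z) i ∩ Ioi 0 :=
      ⟨by simpa using hu, by simp only [mem_Ioi]; linarith⟩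
    rw [h0] at this
    exact this

/-- **"No collision of `i` after `0`" is a measurable event**: on the good set it says that every guarded window count
`#(collision times of i in (0, M])`, `M ∈ ℕ`, vanishes. [folklore] -/
theorem measurableSet_noCollAfter_zero (Φ : Flow σ N) (i : Fin (N + 1)) :
    MeasurableSet {z : Phase N | z ∈ Φ.good ∧
      collisionTimesOf (Torus.geometry (Fin 3)) (hsDiameter σ N) (fun s => Φ.flow s z) i ∩ Ioi 0 = ∅} := by
  set g : ℕ → Phase N → ℕ := fun M z =>
    if z ∈ Φ.good then
      (collisionTimesOf (Torus.geometry (Fin 3)) (hsDiameter σ N) (fun u => Φ.flow u z) i ∩ Ioc 0 (M : ℝ)).ncard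
    else 0 with hg
  have hgm : ∀ M, Measurable (g M) := fun M => measurable_ite_ncard_collisionTimesOf_inter_Ioc Φ i (M : ℝ)
  have hrepr : {z : Phase N | z ∈ Φ.good ∧
      collisionTimesOf (Torus.geometry (Fin 3)) (hsDiameter σ N) (fun s => Φ.flow s z) i ∩ Ioi 0 = ∅} =
      Φ.good ∩ ⋂ M : ℕ, (g M) ⁻¹' {0} := by
    ext z
    simp only [mem_setOf_eq, mem_inter_iff, mem_iInter, mem_preimage, mem_singleton_iff]
    constructor
    · rintro ⟨hz, h0⟩
      refine ⟨hz, fun M => ?_⟩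
      simp only [hg, hz, if_true]
      have : collisionTimesOf (Torus.geometry (Fin 3)) (hsDiameter σ N) (fun u => Φ.flow u z) i ∩ Ioc 0 (M : ℝ) = ∅ := by
        apply Set.eq_empty_of_subset_empty
        rw [← h0]
        exact inter_subset_inter_right _ Ioc_subset_Ioi_self
      rw [this, Set.ncard_empty]
    · rintro ⟨hz, hall⟩
      refine ⟨hz, ?_⟩
      have hfin : ∀ b, (collisionTimesOf (Torus.geometry (Fin 3)) (hsDiameter σ N) (fun u => Φ.flow u z) i ∩
          Ioc 0 b).Finite := fun b =>
        ((Φ.isTrajectory z hz).locFinite 0 b).subset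
          (inter_subset_inter (collisionTimesOf_subset _ i) Ioc_subset_Icc_self)
      ext s
      simp only [mem_inter_iff, mem_Ioi, mem_empty_iff_false, iff_false, not_and, not_lt]
      intro hs
      by_contra hpos
      push Not at hpos
      have hM := hall ⌈s⌉₊
      simp only [hg, hz, if_true] at hM
      have hmem : s ∈ collisionTimesOf (Torus.geometry (Fin 3)) (hsDiameter σ N) (fun u => Φ.flow u z) i ∩
          Ioc 0 ((⌈s⌉₊ : ℕ) : ℝ) := ⟨hs, hpos, Nat.le_ceil s⟩
      have hpos' := (Set.ncard_pos (hfin _)).2 ⟨s, hmem⟩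
      omega
  rw [hrepr]
  exact Φ.measurableSet_good.inter (MeasurableSet.iInter fun M => (hgm M) (measurableSet_singleton 0))

/-- **Under the invariant canonical law, "no collision of `i` after `T`" has the same mass for every `T`**
(constant profiles `c, θ > 0`, drift `u`, `σ ≤ 1/2`; `Φ_T` preserves `G` and the good set is `G`-conull). [folklore] -/
theorem measure_noCollAfter_eq {c θ : ℝ} (u : V3) (Φ : Flow σ N) (i : Fin (N + 1)) (T : ℝ) :
    localGibbsLaw σ (fun _ => c) (fun _ => u) (fun _ => θ) N Φ {z : Phase N | z ∈ Φ.good ∧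
      collisionTimesOf (Torus.geometry (Fin 3)) (hsDiameter σ N) (fun s => Φ.flow s z) i ∩ Ioi T = ∅} =
    localGibbsLaw σ (fun _ => c) (fun _ => u) (fun _ => θ) N Φ {z : Phase N | z ∈ Φ.good ∧
      collisionTimesOf (Torus.geometry (Fin 3)) (hsDiameter σ N) (fun s => Φ.flow s z) i ∩ Ioi 0 = ∅} := by
  set G := localGibbsLaw σ (fun _ => c) (fun _ => u) (fun _ => θ) N Φ with hG
  rw [noCollAfter_eq_inter_preimage Φ i T, inter_comm,
    measure_inter_conull (localGibbsLaw_compl_good_eq_zero Φ)]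
  exact (measurePreserving_flow_localGibbsLaw_const σ c θ u N Φ T).measure_preimage
    (measurableSet_noCollAfter_zero Φ i).nullMeasurableSet

/-- **NO LAST COLLISION: under the invariant canonical law, the orbits on which sphere `i` collides at least once after
time `0` but only finitely often form a null set** (`c, θ > 0`, `σ ≤ 1/2`, every flow, every drift). Proof: the events
"no collision after `M`", `M ∈ ℕ`, all have the mass of "no collision after `0`" (`measure_noCollAfter_eq`) and increase
to "finitely many collisions after `0`", which therefore has that same mass; the difference set is null. [folklore] -/
theorem measure_finitelyManyCollisions_eq_zero {c θ : ℝ} (hc : 0 < c) (hθ : 0 < θ) (u : V3) (hσ2 : σ ≤ 1 / 2)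
    (Φ : Flow σ N) (i : Fin (N + 1)) :
    localGibbsLaw σ (fun _ => c) (fun _ => u) (fun _ => θ) N Φ {z : Phase N | z ∈ Φ.good ∧
      (collisionTimesOf (Torus.geometry (Fin 3)) (hsDiameter σ N) (fun s => Φ.flow s z) i ∩ Ioi 0).Nonempty ∧
      ∃ T : ℝ, collisionTimesOf (Torus.geometry (Fin 3)) (hsDiameter σ N) (fun s => Φ.flow s z) i ∩ Ioi T = ∅} = 0 := by
  set G := localGibbsLaw σ (fun _ => c) (fun _ => u) (fun _ => θ) N Φ with hG
  haveI : IsProbabilityMeasure G := isProbabilityMeasure_localGibbsLaw continuous_const continuous_const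
    continuous_const (fun _ => hc) (fun _ => hθ) hσ2 N Φ
  set F : ℝ → Set (Phase N) := fun T => {z : Phase N | z ∈ Φ.good ∧
      collisionTimesOf (Torus.geometry (Fin 3)) (hsDiameter σ N) (fun s => Φ.flow s z) i ∩ Ioi T = ∅} with hF
  have hmono : Monotone fun M : ℕ => F M := by
    intro M M' hMM' z hz
    refine ⟨hz.1, Set.eq_empty_of_subset_empty ?_⟩
    rw [← hz.2]
    exact inter_subset_inter_right _ (Ioi_subset_Ioi (by exact_mod_cast hMM'))
  have hmass : ∀ M : ℕ, G (F M) = G (F 0) := fun M => by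
    have h := measure_noCollAfter_eq (c := c) (θ := θ) u Φ i (M : ℝ)
    simpa only [hF, Nat.cast_zero] using h
  have hUnion : G (⋃ M : ℕ, F M) = G (F 0) := by
    rw [hmono.measure_iUnion]
    simp_rw [hmass]
    exact ciSup_const
  have hsub0 : F 0 ⊆ ⋃ M : ℕ, F M := by
    simpa only [Nat.cast_zero] using subset_iUnion (fun M : ℕ => F M) 0
  have hdiff : G ((⋃ M : ℕ, F M) \ F 0) = 0 := by
    have hF0m : MeasurableSet (F 0) := by
      simpa only [hF] using measurableSet_noCollAfter_zero Φ i
    rw [measure_sdiff hsub0 hF0m.nullMeasurableSet (measure_ne_top G _), hUnion, tsub_self]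
  refine measure_mono_null ?_ hdiff
  rintro z ⟨hz, hne, T, hT⟩
  refine ⟨mem_iUnion.2 ⟨⌈max T 0⌉₊, hz, Set.eq_empty_of_subset_empty ?_⟩, ?_⟩
  · rw [← hT]
    refine inter_subset_inter_right _ (Ioi_subset_Ioi ?_)
    exact (le_max_left T 0).trans (Nat.le_ceil _)
  · rintro ⟨-, h0⟩
    rw [h0] at hne
    exact Set.not_nonempty_empty hne

/-- **Almost surely under the invariant law, a sphere that collides once after time `0` collides after every time**
(the a.e. form of `measure_finitelyManyCollisions_eq_zero`). [folklore] -/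
theorem ae_collisions_unbounded {c θ : ℝ} (hc : 0 < c) (hθ : 0 < θ) (u : V3) (hσ2 : σ ≤ 1 / 2)
    (Φ : Flow σ N) (i : Fin (N + 1)) :
    ∀ᵐ z ∂(localGibbsLaw σ (fun _ => c) (fun _ => u) (fun _ => θ) N Φ), z ∈ Φ.good →
      (collisionTimesOf (Torus.geometry (Fin 3)) (hsDiameter σ N) (fun s => Φ.flow s z) i ∩ Ioi 0).Nonempty →
      ∀ T : ℝ, (collisionTimesOf (Torus.geometry (Fin 3)) (hsDiameter σ N) (fun s => Φ.flow s z) i ∩ Ioi T).Nonempty := by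
  have h := measure_eq_zero_iff_ae_notMem.1 (measure_finitelyManyCollisions_eq_zero hc hθ u hσ2 Φ i)
  filter_upwards [h] with z hz
  intro hgood hne T
  by_contra hT
  rw [not_nonempty_iff_eq_empty] at hT
  exact hz ⟨hgood, hne, T, hT⟩

/-! ## The enumeration of collision times is genuine almost everywhere -/

/-- **`G`-a.e., for every index `n`: `n < cnt_i(τ)` iff the `n`-th collision time of `i` lies in `(0, τ]`.** On the good
set either `i` never collides after `0` (then every `t_{i,n}` is the junk `0 ∉ (0, τ]` and `cnt_i = 0`), or — almost surely,
`ae_collisions_unbounded` — its collision times are unbounded and locally finite, and the enumeration lists them increasingly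
(`lt_ncard_of_nthTimeAfter_le`; the forward implication `nthCollisionTimeOf_mem_Ioc_of_lt_cnt` holds everywhere). [folklore] -/
theorem ae_lt_cnt_iff_mem_Ioc {c θ : ℝ} (hc : 0 < c) (hθ : 0 < θ) (u : V3) (hσ2 : σ ≤ 1 / 2)
    (Φ : Flow σ N) (τ : ℝ) (i : Fin (N + 1)) :
    ∀ᵐ z ∂(localGibbsLaw σ (fun _ => c) (fun _ => u) (fun _ => θ) N Φ),
      ∀ n : ℕ, n < cnt Φ τ z i ↔ Φ.nthCollisionTimeOf i n z ∈ Ioc 0 τ := by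
  have hgood : ∀ᵐ z ∂(localGibbsLaw σ (fun _ => c) (fun _ => u) (fun _ => θ) N Φ), z ∈ Φ.good :=
    mem_ae_iff.2 (localGibbsLaw_compl_good_eq_zero Φ)
  filter_upwards [hgood, ae_collisions_unbounded hc hθ u hσ2 Φ i] with z hz hunb
  intro n
  set S : Set ℝ := collisionTimesOf (Torus.geometry (Fin 3)) (hsDiameter σ N) (fun s => Φ.flow s z) i with hS
  have htn : Φ.nthCollisionTimeOf i n z = nthTimeAfter S 0 n := rfl
  have hfin : ∀ b, (S ∩ Ioc 0 b).Finite := fun b =>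
    ((Φ.isTrajectory z hz).locFinite 0 b).subset (inter_subset_inter (collisionTimesOf_subset _ i) Ioc_subset_Icc_self)
  refine ⟨fun h => nthCollisionTimeOf_mem_Ioc_of_lt_cnt Φ τ z i h, fun h => ?_⟩
  by_cases hne : (S ∩ Ioi 0).Nonempty
  · have hunb' : ∀ x, 0 ≤ x → (S ∩ Ioi x).Nonempty := fun x _ => hunb hz hne x
    have := lt_ncard_of_nthTimeAfter_le hfin hunb' (n := n) (b := τ) (by rw [← htn]; exact h.2)
    simpa only [cnt, hS] using this
  · rw [not_nonempty_iff_eq_empty] at hne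
    have h0 := nthTimeAfter_eq_zero_of_empty hne n
    rw [← htn] at h0
    rw [h0] at h
    exact absurd h.1 (lt_irrefl 0)

/-- **Registered sub-goal `enumerationGenuineAE` (fully quantified form of `ae_lt_cnt_iff_mem_Ioc`):** under the invariant
canonical law `localGibbsLaw σ c u θ N Φ` (`c, θ > 0`, `σ ≤ 1/2`), almost surely, for every `n`, `n < cnt_i(τ)` iff the `n`-th
collision time of `i` lies in `(0, τ]`. [folklore] -/
theorem enumerationGenuineAE : ∀ (σ : ℝ) (N : ℕ) (c θ : ℝ), 0 < c → 0 < θ → ∀ (u : V3), σ ≤ 1 / 2 →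
    ∀ (Φ : Flow σ N) (τ : ℝ) (i : Fin (N + 1)),
    ∀ᵐ z ∂(localGibbsLaw σ (fun _ => c) (fun _ => u) (fun _ => θ) N Φ),
      ∀ n : ℕ, n < cnt Φ τ z i ↔ Φ.nthCollisionTimeOf i n z ∈ Ioc 0 τ :=
  fun _ _ _ _ hc hθ u hσ2 Φ τ i => ae_lt_cnt_iff_mem_Ioc hc hθ u hσ2 Φ τ i

end NoLast

end Summit.AtomisticToContinuum.HydrodynamicLimit.Theorems.KickFairRelEquilibriumMesoLine

end
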